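import Literature.Geometry.Lorentzian.CoordVolumeForm
import Literature.Geometry.Lorentzian.CoordTensorNorm
import HarnessLib

/-!
# The Hodge star on curvature-type component fields in dimension four, and `∇⋆ = ⋆∇`

Rank-generic coordinate tensor calculus (`CoordTensorCalculus.lean`, `CoordVolumeForm.lean`):
metric components `G` on an open set `V` of a `4`-dimensional space `E` with basis
`b : Basis (Fin 4) ℝ E`, volume form `ε = volForm G b` (`∇ε = 0`, `IsMetricOn.tcov_volForm`).
For a covariant `4`-tensor field in components `T : E → (Fin 4 → Fin 4) → ℝ` (e.g. the lowered
curvature `rm4`) we define **the Hodge star on the first pair**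

  `(⋆T)_{i j k l} = ½ Σ g^{jj'} g^{pq} ε_{i j p j} … ` — precisely
  `star0 G b T y I = ½ Σ_{j,k,p,q} g^{jk}(y) g^{pq}(y) ε_{I₀ I₁ p j}(y) T_{q k I₂ I₃}(y)`

(`= ½ ε_{ij}{}^{cd} T_{cd kl}`; Besse 1987, 1.51, 13.7; Gursky–LeBrun 1999, §2, (deco): `Λ² = Λ⁺ ⊕ Λ⁻`
the `±1`-eigenspaces of `⋆`), as the composite `½ · tr tr (ε ⊗ T)` of the operations of
`CoordTensorCalculus.lean` (`star0 = (1/2) • ttr (ttr (treindex starEquiv (tprod ε T)))`), so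
that the derivation rules of that file apply:

* `star0_apply` — the explicit formula above; `star0_apply_of_orthonormal` — in a
  `G_x`-orthonormal basis `(⋆T)_I(x) = ½ Σ_{p,j} sgnDet(I₀,I₁,p,j) T_{p j I₂ I₃}(x)`;
* `star1`, `star2` — the star on the last four slots of fields with one or two prepended
  (derivative) slots, slice-wise;
* **`IsMetricOn.tcov_star0` — `∇(⋆T) = ⋆(∇T)`**: `(∇_m ⋆T)_I = (⋆ (∇_m T))_I` at points of `V`
  (Riemannian components), from `∇ε = 0`, the Leibniz rule `tcov_tprod`, and the commutation of
  `∇` with relabelling and metric traces (`tcov_treindex`, `tcov_ttr`) — O'Neill 1983, Ch. 7,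
  Lemma 7.19 with Ch. 2, Prop. 2.13; and one rank up, **`IsMetricOn.tcov_star1`**
  (`∇(⋆∇T) = ⋆(∇∇T)`), through the slice formula `tcov_apply_ocons_ocons`;
* smoothness on `V` (`IsMetricOn.tsmoothOn_star0`, `tsmoothOn_star1`).

This is the input `∇W⁺ = (∇W)⁺`, `ΔW⁺ = (ΔW)⁺` of Derdziński's Weitzenböck formula for the
self-dual Weyl tensor (Gursky–LeBrun 1999, (1.3)). Everything is proved; the definitions are
explicit composites.

## References

* A. L. Besse, *Einstein manifolds*, Springer 1987, 1.51 and 13.7–13.9 (Hodge star, `Λ⁺ ⊕ Λ⁻`,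
  `W = W⁺ + W⁻`). [Besse1987]
* B. O'Neill, *Semi-Riemannian geometry*, Academic Press 1983, Ch. 2, Prop. 2.13; Ch. 7,
  Lemma 7.19. [ONeill1983]
* M. J. Gursky, C. LeBrun, Ann. Global Anal. Geom. 17 (1999) 315–328, §2 (deco), §3 (1.3).
  [GurskyLebrun1999]
-/

noncomputable section

open Set Filter Module Function
open scoped Topology ContDiff

namespace Literature.Geometry.Lorentzian

namespace MetricCoord

/-! ### The slot bookkeeping -/

/-- The relabelling of the eight slots of `ε ⊗ T` which presents the slots to be contracted
(`ε₂ ~ T₀`, `ε₃ ~ T₁`) as the two outermost pairs of `ttr ∘ ttr`, and orders the free slots as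
`(ε₀, ε₁, T₂, T₃)`. [folklore] -/
def starEquiv : Fin 4 ⊕ Fin 4 ≃ Option (Option (Option (Option (Fin 4)))) where
  toFun := Sum.elim
    ![some (some (some (some 0))), some (some (some (some 1))), none, some (some none)]
    ![some none, some (some (some none)), some (some (some (some 2))), some (some (some (some 3)))]
  invFun := fun o ↦ o.elim (Sum.inl 2) fun o ↦ o.elim (Sum.inr 0) fun o ↦ o.elim (Sum.inl 3)
    fun o ↦ o.elim (Sum.inr 1) ![Sum.inl 0, Sum.inl 1, Sum.inr 2, Sum.inr 3]
  left_inv := fun s ↦ by rcases s with k | k <;> fin_cases k <;> rfl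
  right_inv := fun o ↦ by
    rcases o with _ | _ | _ | _ | k
    · rfl
    · rfl
    · rfl
    · rfl
    · fin_cases k <;> rfl

/-- The `ε`-slots of the relabelled index `(p, q, j, k, I)`: `(I₀, I₁, p, j)`. [folklore] -/
theorem ocons_starEquiv_inl (p q j k : Fin 4) (I : Fin 4 → Fin 4) :
    ((ocons p (ocons q (ocons j (ocons k I))) ∘ ⇑starEquiv) ∘ Sum.inl : Fin 4 → Fin 4) =
      ![I 0, I 1, p, j] := by
  funext a
  fin_cases a <;> rfl

/-- The `T`-slots of the relabelled index `(p, q, j, k, I)`: `(q, k, I₂, I₃)`. [folklore] -/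
theorem ocons_starEquiv_inr (p q j k : Fin 4) (I : Fin 4 → Fin 4) :
    ((ocons p (ocons q (ocons j (ocons k I))) ∘ ⇑starEquiv) ∘ Sum.inr : Fin 4 → Fin 4) =
      ![q, k, I 2, I 3] := by
  funext a
  fin_cases a <;> rfl

/-- The derivative slot of the relabelled `6`-slot index is the prepended one. [folklore] -/
theorem ocons_starEquiv_optionCongr_none (m p q j k : Fin 4) (I : Fin 4 → Fin 4) :
    ((ocons m (ocons p (ocons q (ocons j (ocons k I))))) ∘ ⇑(starEquiv.optionCongr)) none = m := rfl

/-- The `ε`-slots of the relabelled `6`-slot index: `(I₀, I₁, p, j)`. [folklore] -/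
theorem ocons_starEquiv_optionCongr_inl (m p q j k : Fin 4) (I : Fin 4 → Fin 4) :
    ((ocons m (ocons p (ocons q (ocons j (ocons k I))))) ∘ ⇑(starEquiv.optionCongr)) ∘ some ∘ Sum.inl =
      ![I 0, I 1, p, j] := by
  funext a
  fin_cases a <;> rfl

/-- The `T`-slots of the relabelled `6`-slot index: `(q, k, I₂, I₃)`. [folklore] -/
theorem ocons_starEquiv_optionCongr_inr (m p q j k : Fin 4) (I : Fin 4 → Fin 4) :
    ((ocons m (ocons p (ocons q (ocons j (ocons k I))))) ∘ ⇑(starEquiv.optionCongr)) ∘ some ∘ Sum.inr =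
      ![q, k, I 2, I 3] := by
  funext a
  fin_cases a <;> rfl

/-! ### The Hodge star on the first pair -/

section Star

variable {E : Type*} [NormedAddCommGroup E] [NormedSpace ℝ E] [FiniteDimensional ℝ E]
  (G : E → E →L[ℝ] E →L[ℝ] ℝ) (b : Basis (Fin 4) ℝ E)

/-- **The Hodge star on the first pair** of a covariant `4`-tensor field in components:
`⋆T = ½ tr tr (ε ⊗ T)` with the contractions `ε₂ ~ T₀`, `ε₃ ~ T₁`, i.e.
`(⋆T)_{ijkl} = ½ ε_{ij}{}^{cd} T_{cdkl}` (`star0_apply`). [cite: Besse1987, 1.51 and 13.7] -/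
def star0 (T : E → (Fin 4 → Fin 4) → ℝ) : E → (Fin 4 → Fin 4) → ℝ :=
  (1 / 2 : ℝ) • ttr G b (ttr G b (treindex starEquiv (tprod (volForm G b) T)))

/-- The star on the last four slots of a `5`-slot field (one prepended slot), slice-wise:
`(⋆₁S)_{m I} = (⋆ S_{m ·})_I`. [cite: Besse1987, 1.51 and 13.7] -/
def star1 (S : E → (Option (Fin 4) → Fin 4) → ℝ) : E → (Option (Fin 4) → Fin 4) → ℝ :=
  fun y J ↦ star0 G b (fun y' I ↦ S y' (ocons (J none) I)) y (J ∘ some)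

/-- The star on the last four slots of a `6`-slot field (two prepended slots), slice-wise.
[cite: Besse1987, 1.51 and 13.7] -/
def star2 (S : E → (Option (Option (Fin 4)) → Fin 4) → ℝ) :
    E → (Option (Option (Fin 4)) → Fin 4) → ℝ :=
  fun y K ↦ star1 G b (fun y' J ↦ S y' (ocons (K none) J)) y (K ∘ some)

/-- **The explicit formula** `(⋆T)_I = ½ Σ_{j,k,p,q} g^{jk} g^{pq} ε_{I₀ I₁ p j} T_{q k I₂ I₃}`.
[cite: Besse1987, 1.51] -/
theorem star0_apply (T : E → (Fin 4 → Fin 4) → ℝ) (y : E) (I : Fin 4 → Fin 4) :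
    star0 G b T y I = (1 / 2 : ℝ) * ∑ j, ∑ k, ginv G b y j k * ∑ p, ∑ q, ginv G b y p q *
      (volForm G b y ![I 0, I 1, p, j] * T y ![q, k, I 2, I 3]) := by
  simp only [star0, Pi.smul_apply, smul_eq_mul, ttr_apply, treindex_apply, tprod_apply,
    ocons_starEquiv_inl, ocons_starEquiv_inr]

/-- Unfolding lemma for `star1`. [cite: Besse1987, 1.51] -/
theorem star1_apply (S : E → (Option (Fin 4) → Fin 4) → ℝ) (y : E) (J : Option (Fin 4) → Fin 4) :
    star1 G b S y J = star0 G b (fun y' I ↦ S y' (ocons (J none) I)) y (J ∘ some) := rfl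

/-- Unfolding lemma for `star2`. [cite: Besse1987, 1.51] -/
theorem star2_apply (S : E → (Option (Option (Fin 4)) → Fin 4) → ℝ) (y : E)
    (K : Option (Option (Fin 4)) → Fin 4) :
    star2 G b S y K = star1 G b (fun y' J ↦ S y' (ocons (K none) J)) y (K ∘ some) := rfl

/-- `⋆₁` on a slice: `(⋆₁S)_{p I} = (⋆ S_{p·})_I`. [cite: Besse1987, 1.51] -/
theorem star1_apply_ocons (S : E → (Option (Fin 4) → Fin 4) → ℝ) (y : E) (p : Fin 4)
    (I : Fin 4 → Fin 4) : star1 G b S y (ocons p I) = star0 G b (fun y' I' ↦ S y' (ocons p I')) y I := rfl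

/-- The slice field of `⋆₁S` at `n` is `⋆` of the slice of `S`. [cite: Besse1987, 1.51] -/
theorem star1_slice (S : E → (Option (Fin 4) → Fin 4) → ℝ) (n : Fin 4) :
    (fun y J ↦ star1 G b S y (ocons n J)) = star0 G b (fun y' I' ↦ S y' (ocons n I')) := by
  funext y J
  rfl

/-- `⋆₂` on a double slice: `(⋆₂R)_{m n I} = (⋆ R_{m n ·})_I`. [cite: Besse1987, 1.51] -/
theorem star2_apply_ocons_ocons (R : E → (Option (Option (Fin 4)) → Fin 4) → ℝ) (y : E)
    (m n : Fin 4) (I : Fin 4 → Fin 4) :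
    star2 G b R y (ocons m (ocons n I)) = star0 G b (fun y' I' ↦ R y' (ocons m (ocons n I'))) y I := rfl

/-- `⋆T` at `y` only depends on `T` at `y`. [folklore] -/
theorem star0_congr_apply {T T' : E → (Fin 4 → Fin 4) → ℝ} {y : E} (h : ∀ I, T y I = T' y I)
    (I : Fin 4 → Fin 4) : star0 G b T y I = star0 G b T' y I := by
  simp only [star0_apply, h]

/-- **In a `G_x`-orthonormal basis**: `(⋆T)_I(x) = ½ Σ_{p,j} sgnDet(I₀, I₁, p, j) T_{p j I₂ I₃}(x)`
(`g^{ij} = δ`, `ε = sgnDet`). [cite: Besse1987, 1.51] -/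
theorem star0_apply_of_orthonormal {x : E} (hx : (G x).IsInvertible)
    (hb : ∀ i k, G x (b i) (b k) = if i = k then 1 else 0) (T : E → (Fin 4 → Fin 4) → ℝ)
    (I : Fin 4 → Fin 4) :
    star0 G b T x I = (1 / 2 : ℝ) * ∑ p, ∑ j, sgnDet ![I 0, I 1, p, j] * T x ![p, j, I 2, I 3] := by
  rw [star0_apply]
  simp only [ginv_of_orthonormal b hb hx, boole_mul, Finset.sum_ite_eq, Finset.mem_univ, if_true,
    volForm_apply_of_orthonormal b hb]
  rw [Finset.sum_comm]

/-- Pointwise linearity of `⋆` used for the slice formula: for `F_y = A_y − Σ_p c_p B^p_y` at `y`,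
`(⋆F)_I(y) = (⋆A)_I(y) − Σ_p c_p (⋆B^p)_I(y)`. [folklore] -/
theorem star0_apply_sub_sum {κ : Type*} [Fintype κ] (A : E → (Fin 4 → Fin 4) → ℝ)
    (B : κ → E → (Fin 4 → Fin 4) → ℝ) (c : κ → ℝ) (y : E) (I : Fin 4 → Fin 4) :
    star0 G b (fun y' I' ↦ A y' I' - ∑ r, c r * B r y' I') y I =
      star0 G b A y I - ∑ r, c r * star0 G b (B r) y I := by
  simp only [star0_apply, mul_sub, Finset.sum_sub_distrib, Finset.mul_sum]
  congr 1
  -- move the sum over `r` outside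
  have h : ∀ (f : Fin 4 → Fin 4 → Fin 4 → Fin 4 → κ → ℝ),
      ∑ j, ∑ k, ∑ p, ∑ q, ∑ r, f j k p q r = ∑ r, ∑ j, ∑ k, ∑ p, ∑ q, f j k p q r := by
    intro f
    calc ∑ j, ∑ k, ∑ p, ∑ q, ∑ r, f j k p q r = ∑ j, ∑ k, ∑ p, ∑ r, ∑ q, f j k p q r :=
          Finset.sum_congr rfl fun j _ ↦ Finset.sum_congr rfl fun k _ ↦
            Finset.sum_congr rfl fun p _ ↦ Finset.sum_comm
      _ = ∑ j, ∑ k, ∑ r, ∑ p, ∑ q, f j k p q r :=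
          Finset.sum_congr rfl fun j _ ↦ Finset.sum_congr rfl fun k _ ↦ Finset.sum_comm
      _ = ∑ j, ∑ r, ∑ k, ∑ p, ∑ q, f j k p q r := Finset.sum_congr rfl fun j _ ↦ Finset.sum_comm
      _ = ∑ r, ∑ j, ∑ k, ∑ p, ∑ q, f j k p q r := Finset.sum_comm
  rw [← h]
  exact Finset.sum_congr rfl fun j _ ↦ Finset.sum_congr rfl fun k _ ↦ Finset.sum_congr rfl fun p _ ↦
    Finset.sum_congr rfl fun q _ ↦ Finset.sum_congr rfl fun r _ ↦ by ring

end Star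

/-! ### The slice formula for `∇` -/

section Slice

variable {E : Type*} [NormedAddCommGroup E] [NormedSpace ℝ E] {G : E → E →L[ℝ] E →L[ℝ] ℝ}
  (b : Basis (Fin 4) ℝ E) {x : E}

/-- **The slice formula for `∇` on a field with a prepended slot**:
`(∇S)_{m n I} = (∇ S_{n·})_{m I} − Σ_p Γ^p_{mn} S_{p I}`. [cite: ONeill1983, Ch. 2, Prop. 2.13] -/
theorem tcov_apply_ocons_ocons (S : E → (Option (Fin 4) → Fin 4) → ℝ) (m n : Fin 4)
    (I : Fin 4 → Fin 4) :
    tcov G b S x (ocons m (ocons n I)) =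
      tcov G b (fun y J ↦ S y (ocons n J)) x (ocons m I) -
        ∑ p, chrCoef G b x m n p * S x (ocons p I) := by
  rw [tcov_apply_ocons, tcov_apply_ocons, Fintype.sum_option]
  simp only [ocons_none, ocons_some, update_ocons_none, update_ocons_some]
  ring

end Slice

/-! ### `∇⋆ = ⋆∇` -/

section Parallel

variable {E : Type*} [NormedAddCommGroup E] [NormedSpace ℝ E] [FiniteDimensional ℝ E]
  [CompleteSpace E] {G : E → E →L[ℝ] E →L[ℝ] ℝ} (b : Basis (Fin 4) ℝ E) {V : Set E} {x : E}

omit [CompleteSpace E] in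
/-- `⋆T` is smooth on `V` for a smooth `T` and Riemannian components. [folklore] -/
theorem IsMetricOn.tsmoothOn_star0 (hG : IsMetricOn G V) (hpos : ∀ y ∈ V, ∀ v : E, v ≠ 0 → 0 < G y v v)
    {T : E → (Fin 4 → Fin 4) → ℝ} (hT : TSmoothOn T V) : TSmoothOn (star0 G b T) V :=
  TSmoothOn.smul _ (hG.tsmoothOn_ttr (hG.tsmoothOn_ttr
    (((hG.tsmoothOn_volForm b hpos).tprod hT).treindex starEquiv)))

omit [CompleteSpace E] in
/-- `⋆₁S` is smooth on `V` for a smooth `S`. [folklore] -/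
theorem IsMetricOn.tsmoothOn_star1 (hG : IsMetricOn G V) (hpos : ∀ y ∈ V, ∀ v : E, v ≠ 0 → 0 < G y v v)
    {S : E → (Option (Fin 4) → Fin 4) → ℝ} (hS : TSmoothOn S V) : TSmoothOn (star1 G b S) V := by
  intro J
  have h := hG.tsmoothOn_star0 b hpos (T := fun y' I ↦ S y' (ocons (J none) I)) (fun I ↦ hS _) (J ∘ some)
  exact h

/-- **`∇⋆ = ⋆∇` on `4`-tensor fields**: `(∇_m (⋆T))_I = (⋆(∇_m T))_I` at points of `V`, for
Riemannian components — `∇ε = 0` (`tcov_volForm`), the Leibniz rule (`tcov_tprod`) and the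
commutation of `∇` with relabelling and traces (`tcov_treindex`, `tcov_ttr`). O'Neill 1983,
Ch. 7, Lemma 7.19 with Ch. 2, Prop. 2.13. [cite: ONeill1983, Ch. 7, Lemma 7.19]
[cite: Besse1987, 13.7] -/
theorem IsMetricOn.tcov_star0 (hG : IsMetricOn G V) (hx : x ∈ V)
    (hpos : ∀ y ∈ V, ∀ v : E, v ≠ 0 → 0 < G y v v) {T : E → (Fin 4 → Fin 4) → ℝ}
    (hT : TSmoothOn T V) (m : Fin 4) (I : Fin 4 → Fin 4) :
    tcov G b (star0 G b T) x (ocons m I) = star1 G b (tcov G b T) x (ocons m I) := by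
  have hε := hG.tsmoothOn_volForm b hpos
  have hP : TSmoothOn (treindex starEquiv (tprod (volForm G b) T)) V := (hε.tprod hT).treindex _
  have hP1 : TSmoothOn (ttr G b (treindex starEquiv (tprod (volForm G b) T))) V := hG.tsmoothOn_ttr hP
  have hP2 : TSmoothOn (ttr G b (ttr G b (treindex starEquiv (tprod (volForm G b) T)))) V :=
    hG.tsmoothOn_ttr hP1
  -- the inner trace: `∇` through `tr`, the relabelling and the product, `∇ε = 0`
  have h2 : ∀ j k, tcov G b (ttr G b (treindex starEquiv (tprod (volForm G b) T))) x
      (ocons m (ocons j (ocons k I))) =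
      ∑ p, ∑ q, ginv G b x p q * (volForm G b x ![I 0, I 1, p, j] *
        tcov G b T x (ocons m ![q, k, I 2, I 3])) := by
    intro j k
    rw [hG.tcov_ttr hP hx]
    refine Finset.sum_congr rfl fun p _ ↦ Finset.sum_congr rfl fun q _ ↦ ?_
    rw [tcov_treindex, treindex_apply, tcov_tprod hG.isOpen hε hT hx]
    simp only [hG.tcov_volForm b hx (hpos x hx), zero_mul, zero_add,
      ocons_starEquiv_optionCongr_none, ocons_starEquiv_optionCongr_inl,
      ocons_starEquiv_optionCongr_inr]
  -- left-hand side: push `∇` through `½ ·` and the outer trace; right-hand side: unfold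
  rw [star0, tcov_smul_apply hG.isOpen hP2 _ hx, hG.tcov_ttr hP1 hx, star1_apply, star0_apply]
  simp only [h2, ocons_none, Function.comp_apply, ocons_some]

/-- **`∇⋆ = ⋆∇` one rank up**: `(∇_m (⋆₁S))_{n I} = (⋆₂ (∇S))_{m n I}` at points of `V` — for
`S = ∇T` this is `∇(⋆∇T) = ⋆(∇∇T)`, whence `Δ(⋆T) = ⋆(ΔT)`. From `tcov_star0` on the slices
`S_{n·}` and the slice formula. [cite: ONeill1983, Ch. 7, Lemma 7.19] [cite: Besse1987, 13.7] -/
theorem IsMetricOn.tcov_star1 (hG : IsMetricOn G V) (hx : x ∈ V)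
    (hpos : ∀ y ∈ V, ∀ v : E, v ≠ 0 → 0 < G y v v) {S : E → (Option (Fin 4) → Fin 4) → ℝ}
    (hS : TSmoothOn S V) (m n : Fin 4) (I : Fin 4 → Fin 4) :
    tcov G b (star1 G b S) x (ocons m (ocons n I)) = star2 G b (tcov G b S) x (ocons m (ocons n I)) := by
  have hSn : ∀ n, TSmoothOn (fun y J ↦ S y (ocons n J)) V := fun n J ↦ hS _
  rw [star2_apply_ocons_ocons, tcov_apply_ocons_ocons, star1_slice, hG.tcov_star0 b hx hpos (hSn n) m I,
    star1_apply_ocons]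
  simp only [star1_apply_ocons]
  -- the slice of `∇S` at `(m, n)` is `∇(S_{n·})_m − Σ_p Γ^p_{mn}(x) S_{p·}` (coefficients frozen at `x`)
  have hcongr : star0 G b (fun y' I' ↦ tcov G b S y' (ocons m (ocons n I'))) x I =
      star0 G b (fun y' I' ↦ tcov G b (fun y J ↦ S y (ocons n J)) y' (ocons m I') -
        ∑ p, chrCoef G b x m n p * S y' (ocons p I')) x I :=
    star0_congr_apply G b (fun I' ↦ tcov_apply_ocons_ocons b S m n I') I
  rw [hcongr, star0_apply_sub_sum G b (fun y' I' ↦ tcov G b (fun y J ↦ S y (ocons n J)) y' (ocons m I'))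
    (fun p y' I' ↦ S y' (ocons p I')) (fun p ↦ chrCoef G b x m n p) x I]

end Parallel

end MetricCoord

end Literature.Geometry.Lorentzian

end
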